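import Mathlib
import HarnessLib
import HarnessLib.Audit
import Summits.Langlands.Statement
import Summits.Langlands.Langlands.Theses.OdlyzkoWorldSplit
import Summits.Langlands.Langlands.Theses.HolomorphicLimitSplit
import Summits.Langlands.Langlands.Theses.BrightMateBypass
import Summits.Langlands.Langlands.Theorems.BrightMateBypass
import Literature.NumberTheory.GaloisRepresentations.ResidualGaloisRep
import Literature.NumberTheory.GaloisRepresentations.AdequateSubgroup

/-!
(Tree twin, PART 1 of 2: §1 perfect core + §1b + §2 vocabulary + §3 cells. PART 2 = `Theorems/CoreAdequacySplitKernel.lean`: §4 kernel, §5 root, §6 Cert, §3b one-liners. Split only because Theorems files with proofs are capped at 400 lines; texts byte-identical to the lens node nodes/lens-5-g11-CoreAdequacySplit.lean sha256 dc824d0814a0….)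

# CoreAdequacySplit — decomp-langlands lens 5 («finite/base range + asymptotic regime + bridge»), generation 11, NODE v2 (v1 + the R1 carves)

TARGET (RESIDUAL MODE, blocker first). F† = `OdlyzkoWorldSplit.IrreducibleSmallPrimeLifting` (stmt-Langlands-33907, crux rank 402, OPEN, never
split): the SMALL-PRIME cell ℓ < 2(n+1) of the gen-8 image/threshold split of Lift_w = `OdlyzkoWorldSplit.AutomorphyLifting` (24016) in the host route
route-Langlands-OdlyzkoWorldSplit (rev 8).  Instances: ρ : Γ_K → GL_n(ℚ̄_ℓ) irreducible, a.e. unramified, de Rham above ℓ, with ρ̄|Γ_{K(ζ_ℓ)}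
absolutely irreducible, ℓ < 2(n+1), LINKED (congruent Frobenius polynomials a.e.) to a weakly automorphic irreducible ρ'; IH = Lift_w below n over
every number field; conclusion: ρ is weakly automorphic (an L-algebraic cuspidal π, Satake–Frobenius compatible a.e.).  `FDagger ↔ F†` is `Iff.rfl`.

THE CUT (lens 5: finite/base range + asymptotic regime + bridge — but the honest «range» turns out to be the IMAGE, not the prime).  The lifting
ENGINES carry no prime threshold: Thorne 2012 Thm 7.1 = BLGGT Thm 2.2.1 and BLGGT Thm 2.3.1/2.3.2 assume exactly «r̄(G_{F(ζ_l)}) adequate»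
[corpus:paper:arxiv-1010.2561 p19–20]; «ℓ ≥ 2(n+1)» is only GHTT's sufficient criterion for adequacy (BLGGT Prop 2.1.2, used in Thm 4.2.1 [ibid. p26]).
So F† is cut by two DIALS on the residual image I = τ(Γ_{K(ζ_ℓ)}) (τ an absolutely irreducible reduction of ρ|Γ_{K(ζ_ℓ)}, tree `IsReductionOf`):
* ADQ  `AdequateCyclotomicImage ρ`  — I is Thorne-adequate (tree `Subgroup.IsThorneAdequate`): the engines' LITERAL hypothesis;
* SADQ `SolvablyAdequateImage ρ`    — some J with P ≤ J ≤ I is absolutely irreducible and Thorne-adequate, P = the PERFECT CORE of I (§1,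
  `IsPerfectCore`, first-order and inlined into the route one-liners).  By the Galois correspondence the groups J ⊇ P are exactly the images of ρ̄ over
  the layers M of the finite SOLVABLE Galois hulls N/K (universal hull: N = K(ρ̄,ζ_ℓ)^P), so SADQ says «after a solvable base change INTO K(ρ̄,ζ_ℓ) the
  Taylor–Wiles image hypothesis holds» (the base change SHRINKS an inadequate image — Wiles' SL₂(𝔽₃) ↦ Q₈; BLGGT's own soluble base changes are taken
  linearly disjoint from K(ρ̄,ζ_ℓ) precisely to keep the image [ibid. p25]).
THREE CELLS (§3; each = F†'s text with the dial literals inserted after «ρ̄|Γ_{K(ζ_ℓ)} absolutely irreducible»; each WEAKER than F† — `cells_of_fdagger` —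
and Langlands-implied — §6 `Cert.*`):
* AIL `AdequateImageLifting`     (ADQ)          — ENGINE CELL.  Tag WEAKER / ATTACKABLE-BY-ENGINE (Thorne, BLGGT, ACC+ 6.1.1 verbatim on the polarisable
  regular CM/TR sector; dark elsewhere exactly like A† 33906 — the transverse darkness is lens-2's axis, not re-cut here).
* SBL `SolvablyAdequateLifting`  (¬ADQ ∧ SADQ)  — BRIDGE CELL.  Tag WEAKER / CLOSED-IN-PRINT modulo AIL + W⁺: support TRANS `SolvableAdequacyTransport
  := W⁺ → AUT↑ → CSD → AIL → SBL` (§3), print: link (π, ρ') ascends K → N by AUT↑ = `BrightMateBypass.SolvableAscentConstituent` (27679), descends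
  N → M by CSD = `HolomorphicLimitSplit.CliffordSolvableDescent` (31695; ρ'|M irreducible since J is), AIL at M (IH is field-uniform; ℓ, geometry,
  CycIrr restrict), back M → N (AUT↑) → K (CSD; ρ irreducible over K is F†'s hypothesis).  SBL is NOT a route binder: `sbl_of_transport`.
* RSL `NoAdequateLayerLifting`   (¬ADQ ∧ ¬SADQ ∧ ¬SOLVRED ∧ ¬SOLVM) — DECLARED RESIDUAL «small prime, no adequate layer, solvably irreducible, absolutely
  lone».  The two R1 CARVES (critic rows 167/169 rule of record: a residual books no kit-closable sub-box) are the clauses of route BrightMateBypass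
  VERBATIM — `Theorems.BrightMate.SolvablyReducible ρ` (closed by IH(m) + Serre_w(OW, RES) + W⁺ + CSD: landed `weakAut_of_solvablyReducible`) and
  `Theorems.BrightMate.SolvablyMated ι ρ` (closed by the landed bright-mate bypass `weakAut_of_solvablyMated` modulo BRIGHT + Serre_w + W⁺ + A† + AUT↑ +
  CSD — whatever the prime and the image); node `liftTail_of_carve`.  So RSL ⊆ (LONE‴-type ghost) ∩ (cyclotomically irreducible, ℓ < 2(n+1), no
  adequate layer): conjecturally empty (Fontaine–Mazur + Langlands), no theorem says so.  Tag WEAKER / RESIDUAL / INSTRUMENTABLE on the image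
  coordinates: a FINITE-GROUP TABLE indexed by (n, ℓ < 2(n+1), P, [P, I]).  Rank-2 rows (BLGG13 App. A Prop 6.2.1 + Points 1–7 [corpus:paper:arxiv-1106.5586 p21–24]): ℓ = 2 — all
  (slab ℓ ∣ n: tree `Subgroup.not_isThorneAdequate_of_natCast_eq_zero`, node `not_solvAdequateBetween_of_natCast_eq_zero`); ℓ = 3 — EMPTY (inadequate
  irreducible ⟺ projective image PSL₂(𝔽₃), whose Q₈-layer is adequate above the perfect core 1: Wiles' case sits in SBL); ℓ = 5 — exactly projective
  image PSL₂(𝔽₅)/PGL₂(𝔽₅) (P = SL₂(𝔽₅) inadequate, hence every J ⊇ P): the classical p = 5 exception of Wiles/Kisin (GL₂ engines over totally real K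
  exist under Kisin's hypothesis — honest note: RSL is the residual of the ADEQUACY technology as typed in the tree, see KILL (ii) of the route).
  Rows n < ℓ < 2(n+1): Guralnick–Herzig–Tiep Thm 1.3 exception list [corpus:paper:arxiv-1311.1786 p3–4]; none for ℓ ≥ n+4, ℓ ≠ 2n±1 (Whitmore Thm 4.2
  [corpus:paper:arxiv-2205.05062 p64]); rows ℓ ≤ n from n = 3 on: uncatalogued (instrument ask below).
* FRAME `SmallPrimeLiftingFrame := F† → Langlands` (support; content = the host route verbatim with F† abstracted: `frame_of_host`).

ORBIT ANALYSIS (critic row 6 — why RSL is not a costume of AIL).  KERNEL III (§1, PROVED): a normal subgroup with solvable quotient has the SAME perfect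
core (`IsPerfectCore.of_normal_of_isSolvable_quotient`, via `IsPerfectCore.unique` / `eq_bot_of_perfect_of_isSolvable`); KERNEL III′ (§1b, PROVED): hence
«some adequate J above the perfect core» is MONOTONE up the solvable orbit (`SolvAdequateBetween.of_normal_of_isSolvable_quotient`) and its negation is
inherited by every solvable Galois restriction (`not_solvAdequateBetween_of_normal_of_isSolvable_quotient`).  The transport moves available in the tree
(solvable Galois restriction AUT↑, solvable descent CSD) therefore never lead from an AIL- or SBL-instance to an RSL-instance, and the carve clauses are
themselves inherited by solvable Galois restrictions (¬SOLVRED: Galois closure of a solvable tower is solvable; ¬SOLVM: by definition over layers of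
hulls; BrightMateBypass memo §4): the residual is EXACTLY closed under the kit-transferable moves (R2).  (The v0 design with dial «perfect core adequate» leaked: Wiles' SL₂(𝔽₃) at ℓ = 3 has trivial core yet is reachable from AIL through Q₈ — that is
now the BRIDGE cell by construction.)

KERNEL (0 sorry; axioms propext / Classical.choice / Quot.sound):  KERNEL I `fdagger_iff_cells` : F† ⟺ AIL ∧ SBL ∧ RSL modulo the CARVE KIT {OW, RES,
W⁺, A†, BRIGHT, AUT↑, CSD} (tree items by name; two excluded middles on the dials, `dial_trichotomy`, one on the carve, `liftTail_of_carve`; 0 EQUIV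
layers: the cells are implications with extra hypotheses; cells ⟸ F† OUTRIGHT, `cells_of_fdagger`), `IrreducibleSmallPrimeLifting_iff_cells` on the tree
decl; ROOT `closes` (16 binders: AIL, RSL, TRANS, BRIGHT, AUT↑, CSD + the host's A†, RPO, RNO₂, RNO₃, OW, RES, W⁺, P, L∤R, CRD) := `OdlyzkoWorldSplit.closes …
(liftw_of_cells …)` through the CLOSED resplit glue `Theorems.AutomorphyLifting_of_slopesplit_proof`; CHILD-ROUTE deciding theorem `closes_framed` (11
binders AIL, RSL, W⁺, AUT↑, CSD, TRANS, FRAME, OW, RES, BRIGHT, A† — all used; certified `ledger route check --native`: closes OK, binder_used 11/11) and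
`closes_inline` on the §3b one-liners (each `Iff.rfl` to its §3 form: `ail_inline_iff`, `rsl_inline_iff`, `wp_inline_iff`, `autup_inline_iff`,
`csd_inline_iff`, `trans_inline_iff`, `solvred_clause_iff`, `solvm_clause_iff`; the dedup items OW/RES/A†/BRIGHT are byte-identical host /
BrightMateBypass one-liners); §6 `Cert.*`: Langlands ⟹ Lift_w ⟹ F† ⟹ each cell, Langlands ⟹ FRAME.

NOVELTY (one sentence).  No node of the cell and nothing found in print cuts a LIFTING statement by «Thorne-adequate after a solvable base change into the
kernel field» — lens-4 g2/g14 (ResidualSolvabilitySplit / InsolubleResidueReduction) use the perfect core on the SERRE side (solvable vs insoluble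
image, residual automorphy), BLGGT/BLGHT base-change AWAY from K(ρ̄,ζ_ℓ); here the shrinking direction is the cell boundary and its orbit-closure is a
proved lemma.  DISTINCTNESS: vs g8 ImageThresholdSplit (prime threshold; this node refines its small-prime cell by the image), vs g10 BrightMateBypass
(compatible-family matedness of the GHOST cell; disjoint target), vs lens-4 (Serre-side solvability of Gal(K(ρ̄)/K); here J ranges between the perfect
core and the image over K(ζ_ℓ) and the statement cut is automorphy LIFTING with a link, not residual automorphy).

BARRIERS.  ResiduallyReducibleBarrier: outside (CycIrr is F†'s hypothesis; AIL is the barrier's printed escape; RSL is its shadow «small image» made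
precise).  SolvableImageBarrier: TRANS/SGA/CSD inside the class but inside its PROVED scope (finite solvable Galois layers, Arthur–Clozel); RSL is where no
solvable layer helps.  TaylorWilesNumericalCoincidence / PatchingLocalComponent / NonRegularWeight: bind AIL exactly as every TW engine (its dark corner:
general K, irregular weights) — not claimed otherwise.

INSTRUMENT ASK (census-1, GAP, minutes; kit_allowed = false for this seat): for n ∈ {2,3,4}, primes ℓ < 2(n+1), absolutely irreducible I ≤ GL_n(𝔽_{ℓ^a})
(a ≤ 3) up to conjugacy: perfect core P (derived series), the interval [P, I], Thorne-adequacy of each J clause by clause ((i) Hom(J, k) = 0, (ii) scalar-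
free H⁰, (iii) H¹(J, ad⁰) = 0 via cohomolo, (iv) spanning by semisimple-eigenprojections); print the RSL rows.  Acceptance test: rank-2 rows = BLGG13 Prop
6.2.1 (ℓ = 2 all; ℓ = 3 none; ℓ = 5 ⟺ projective image PSL₂(5)/PGL₂(5)).

NAMESPACE `Summit.Langlands.Langlands.Theorems.CoreAdequacy` (≠ the route's `…Theses.CoreAdequacySplit`, so a census tree twin `Theorems/CoreAdequacySplit.lean`
cannot clash with the born route file; cell convention, g10 / lens-3 precedent).

FILES (kit HOME/nodes/lens-5-g11-CoreAdequacySplit.*): this node; `.md` memo; `childroute.route.json` + `childroute.glue.lean` (schema OK, --native closes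
OK 11/11, tribunal --full tk=PROVISIONAL); `birth_RSL.lean` (BC3/BC5: stubs RUNG (2,3) / SLAB ℓ ∣ n / TABLE, `NoAdequateLayerLifting_of` proved); bc7
probe files + outputs (all CLEAN); RUNME.md (writer-1 / census-1 steps).
-/

set_option linter.dupNamespace false

namespace Summit.Langlands.Langlands.Theorems.CoreAdequacy

open Filter
open scoped MatrixGroups
open Literature.NumberTheory.GaloisRepresentations
open Summit.Langlands.Langlands.Theses

/-! ## §1 Group theory: the perfect core (solvable residual, perfect radical) of a subgroup -/

section PerfectCore

variable {X : Type*} [Group X]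

/-- `P` is **the perfect core** of `G` (inside the ambient group `X`): the largest perfect subgroup of `G` — `P ≤ G`, `⁅P, P⁆ = P`, and every
perfect `Q ≤ G` lies in `P`.  For a finite group this is the last term `𝒟^∞(G)` of the derived series (the solvable residual): `G/P` is the largest
solvable quotient and `P` is characteristic.  First-order over Mathlib's subgroup commutator, so that the dial below inlines into a route one-liner. -/
def IsPerfectCore (G P : Subgroup X) : Prop :=
  P ≤ G ∧ ⁅P, P⁆ = P ∧ ∀ Q : Subgroup X, Q ≤ G → ⁅Q, Q⁆ = Q → Q ≤ P

/-- The perfect core as a subgroup: the join of all perfect subgroups of `G`. -/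
def perfectCore (G : Subgroup X) : Subgroup X :=
  sSup {Q : Subgroup X | Q ≤ G ∧ ⁅Q, Q⁆ = Q}

omit [Group X] in
/-- A subgroup is closed under its own commutators: `⁅Q, Q⁆ ≤ Q`. -/
theorem commutator_self_le [Group X] (Q : Subgroup X) : ⁅Q, Q⁆ ≤ Q :=
  Subgroup.commutator_le.2 fun _ ha _ hb => Q.mul_mem (Q.mul_mem (Q.mul_mem ha hb) (Q.inv_mem ha)) (Q.inv_mem hb)

/-- A join of perfect subgroups is perfect. -/
theorem sSup_perfect {S : Set (Subgroup X)} (hS : ∀ Q ∈ S, ⁅Q, Q⁆ = Q) : ⁅sSup S, sSup S⁆ = sSup S := by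
  refine le_antisymm (commutator_self_le _) (sSup_le fun Q hQ => ?_)
  calc Q = ⁅Q, Q⁆ := (hS Q hQ).symm
    _ ≤ ⁅sSup S, sSup S⁆ := Subgroup.commutator_mono (le_sSup hQ) (le_sSup hQ)

/-- `perfectCore G` IS the perfect core of `G` (existence). -/
theorem isPerfectCore_perfectCore (G : Subgroup X) : IsPerfectCore G (perfectCore G) := by
  refine ⟨sSup_le fun Q hQ => hQ.1, sSup_perfect fun Q hQ => hQ.2, fun Q hQG hQ => ?_⟩
  exact le_sSup ⟨hQG, hQ⟩

/-- Uniqueness: the perfect core is determined by `G`. -/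
theorem IsPerfectCore.unique {G P P' : Subgroup X} (h : IsPerfectCore G P) (h' : IsPerfectCore G P') : P = P' :=
  le_antisymm (h'.2.2 P h.1 h.2.1) (h.2.2 P' h'.1 h'.2.1)

/-- `IsPerfectCore G P ↔ P = perfectCore G`. -/
theorem isPerfectCore_iff_eq {G P : Subgroup X} : IsPerfectCore G P ↔ P = perfectCore G :=
  ⟨fun h => h.unique (isPerfectCore_perfectCore G), fun h => h ▸ isPerfectCore_perfectCore G⟩

/-- A perfect subgroup of a solvable group is trivial (it lies in every term of the derived series). -/
theorem eq_bot_of_perfect_of_isSolvable {Y : Type*} [Group Y] [hY : IsSolvable Y] (Q : Subgroup Y) (hQ : ⁅Q, Q⁆ = Q) : Q = ⊥ := by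
  obtain ⟨m, hm⟩ := (isSolvable_def Y).1 hY
  have key : ∀ k : ℕ, Q ≤ derivedSeries Y k := by
    intro k
    induction k with
    | zero => simp [derivedSeries_zero]
    | succ k ih => rw [derivedSeries_succ, ← hQ]; exact Subgroup.commutator_mono ih ih
  exact le_bot_iff.1 (hm ▸ key m)

/-- **ORBIT LEMMA (solvable restriction).**  If `H ≤ G` is normal in `G` with solvable quotient `G/H`, then `H` and `G` have THE SAME perfect core.
(Applied to `H = ρ̄(Γ_{L(ζ_ℓ)}) ◁ G = ρ̄(Γ_{K(ζ_ℓ)})` for a solvable Galois `L/K`: the dial `AdequateCore` is invariant under solvable base change, in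
BOTH directions.) -/
theorem IsPerfectCore.of_normal_of_isSolvable_quotient {G H P : Subgroup X} (hHG : H ≤ G)
    [hN : (H.subgroupOf G).Normal] (hsolv : IsSolvable (G ⧸ H.subgroupOf G)) (hP : IsPerfectCore G P) : IsPerfectCore H P := by
  obtain ⟨hPG, hPP, hmax⟩ := hP
  refine ⟨?_, hPP, fun Q hQH hQ => hmax Q (hQH.trans hHG) hQ⟩
  -- the image of `P` in `G/H` is perfect, hence trivial: `P ≤ H`
  set P₀ : Subgroup G := P.subgroupOf G with hP₀
  have hP₀perf : ⁅P₀, P₀⁆ = P₀ := by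
    apply Subgroup.map_injective G.subtype_injective
    rw [Subgroup.map_commutator, hP₀, Subgroup.subgroupOf_map_subtype, inf_eq_left.2 hPG, hPP]
  have himg : ⁅P₀.map (QuotientGroup.mk' (H.subgroupOf G)), P₀.map (QuotientGroup.mk' (H.subgroupOf G))⁆ =
      P₀.map (QuotientGroup.mk' (H.subgroupOf G)) := by
    rw [← Subgroup.map_commutator, hP₀perf]
  have hbot := eq_bot_of_perfect_of_isSolvable _ himg
  have hle : P₀ ≤ H.subgroupOf G := by
    rw [← QuotientGroup.ker_mk' (H.subgroupOf G), ← Subgroup.map_eq_bot_iff]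
    exact hbot
  -- back in `X`
  have := Subgroup.map_mono (f := G.subtype) hle
  rw [hP₀, Subgroup.subgroupOf_map_subtype, Subgroup.subgroupOf_map_subtype, inf_eq_left.2 hPG] at this
  exact this.trans inf_le_left

/-- In particular the perfect core of `H` and of `G` coincide as subgroups. -/
theorem perfectCore_eq_of_normal_of_isSolvable_quotient {G H : Subgroup X} (hHG : H ≤ G)
    [(H.subgroupOf G).Normal] (hsolv : IsSolvable (G ⧸ H.subgroupOf G)) : perfectCore H = perfectCore G :=
  ((isPerfectCore_perfectCore G).of_normal_of_isSolvable_quotient hHG hsolv).unique (isPerfectCore_perfectCore H) |>.symm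

/-- **Adequacy clause (i) is automatic for a perfect group**: every additive character `P → k` of a perfect `P` vanishes
(`Subgroup.IsThorneAdequate.addMonoidHom_eq_zero` for `H = P`).  So for the perfect core only clauses (ii)–(iv) are in question. -/
theorem addMonoidHom_eq_zero_of_perfect {k : Type*} [AddCommGroup k] (P : Subgroup X) (hP : ⁅P, P⁆ = P) (f : Additive P →+ k) : f = 0 := by
  -- `f` as a monoid hom to `Multiplicative k` kills all commutators, and `P` is generated by its commutators
  have htop : ⁅(⊤ : Subgroup P), (⊤ : Subgroup P)⁆ = ⊤ := by
    apply Subgroup.map_injective P.subtype_injective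
    rw [Subgroup.map_commutator, ← MonoidHom.range_eq_map, Subgroup.range_subtype, hP]
  let φ : P →* Multiplicative k := AddMonoidHom.toMultiplicativeRight f
  have hker : (⊤ : Subgroup P) ≤ φ.ker := by
    rw [← htop, ← commutator_def]
    exact Abelianization.commutator_subset_ker φ
  refine AddMonoidHom.ext fun x => ?_
  have hx : φ (Additive.toMul x) = 1 := (MonoidHom.mem_ker).1 (hker (Subgroup.mem_top _))
  simpa [φ, AddMonoidHom.toMultiplicativeRight] using hx

/-! ### §1b «an adequate layer above the perfect core» — the group-theoretic form of the SOLVABLY-ADEQUATE dial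

For a subgroup `I ≤ GL_n(k)` (the residual image over `K(ζ_ℓ)`), `SolvAdequateBetween I` says: some subgroup `J` with `P ≤ J ≤ I`, `P` the perfect
core of `I`, acts absolutely irreducibly and is Thorne-adequate.  By the Galois correspondence (memo §3) these `J` are EXACTLY the images
`ρ̄(Γ_{M(ζ_ℓ)})` over the layers `M` of the finite solvable Galois hulls `N/K` (`N = K(ρ̄, ζ_ℓ)^{P}` is the universal hull), so the dial reads «after a
solvable base change the Taylor–Wiles image hypothesis holds».  MONOTONE along the solvable orbit (PROVED below from the perfect-core lemma): if
`I' ◁ I` with solvable quotient then `SolvAdequateBetween I' → SolvAdequateBetween I` — hence the RESIDUAL «¬ SolvAdequateBetween» descends to every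
solvable Galois restriction, i.e. no residual instance is reachable from the other two cells by restriction + descent (memo §4, critic row 6). -/

/-- Some intermediate group between the perfect core of `I` and `I` is absolutely irreducible and Thorne-adequate. -/
def SolvAdequateBetween {k : Type*} [Field k] {n : ℕ} (I : Subgroup (GL (Fin n) k)) : Prop :=
  ∃ P J : Subgroup (GL (Fin n) k), IsPerfectCore I P ∧ P ≤ J ∧ J ≤ I ∧ IsAbsIrreducible J.subtype ∧ Subgroup.IsThorneAdequate J

/-- An absolutely irreducible adequate `I` is solvably adequate (`J = I`). -/
theorem solvAdequateBetween_of_adequate {k : Type*} [Field k] {n : ℕ} {I : Subgroup (GL (Fin n) k)}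
    (hirr : IsAbsIrreducible I.subtype) (hadq : Subgroup.IsThorneAdequate I) : SolvAdequateBetween I :=
  ⟨perfectCore I, I, isPerfectCore_perfectCore I, (isPerfectCore_perfectCore I).1, le_rfl, hirr, hadq⟩

/-- An `I` whose perfect core is absolutely irreducible and adequate is solvably adequate (`J = P`; the g11-v0 «CORE» dial). -/
theorem solvAdequateBetween_of_core {k : Type*} [Field k] {n : ℕ} {I P : Subgroup (GL (Fin n) k)} (hP : IsPerfectCore I P)
    (hirr : IsAbsIrreducible P.subtype) (hadq : Subgroup.IsThorneAdequate P) : SolvAdequateBetween I :=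
  ⟨P, P, hP, le_rfl, hP.1, hirr, hadq⟩

/-- **ORBIT MONOTONICITY** (KERNEL III′): a normal subgroup `I' ◁ I` with solvable quotient has the same perfect core, so an adequate layer for
`I'` is one for `I`.  Contrapositive: the residual dial «no adequate layer» is inherited by every solvable Galois restriction. -/
theorem SolvAdequateBetween.of_normal_of_isSolvable_quotient {k : Type*} [Field k] {n : ℕ} {I I' : Subgroup (GL (Fin n) k)} (hle : I' ≤ I)
    [hN : (I'.subgroupOf I).Normal] (hsolv : IsSolvable (I ⧸ I'.subgroupOf I)) (h : SolvAdequateBetween I') : SolvAdequateBetween I := by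
  obtain ⟨P, J, hP, hPJ, hJI, hirr, hadq⟩ := h
  have hP' : IsPerfectCore I P := by
    have h1 : IsPerfectCore I' (perfectCore I) := (isPerfectCore_perfectCore I).of_normal_of_isSolvable_quotient hle hsolv
    rw [hP.unique h1]
    exact isPerfectCore_perfectCore I
  exact ⟨P, J, hP', hPJ, hJI.trans hle, hirr, hadq⟩

/-- The residual dial descends: `¬ SolvAdequateBetween I → ¬ SolvAdequateBetween I'` for `I' ◁ I` with solvable quotient. -/
theorem not_solvAdequateBetween_of_normal_of_isSolvable_quotient {k : Type*} [Field k] {n : ℕ} {I I' : Subgroup (GL (Fin n) k)} (hle : I' ≤ I)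
    [hN : (I'.subgroupOf I).Normal] (hsolv : IsSolvable (I ⧸ I'.subgroupOf I)) (h : ¬ SolvAdequateBetween I) : ¬ SolvAdequateBetween I' :=
  fun h' => h (h'.of_normal_of_isSolvable_quotient hle hsolv)

/-- In the slab `ℓ ∣ n` nothing is adequate (tree: `Subgroup.not_isThorneAdequate_of_natCast_eq_zero`), so no `I` is solvably adequate: the slab is
a ROW of the residual table. -/
theorem not_solvAdequateBetween_of_natCast_eq_zero {k : Type*} [Field k] {n : ℕ} (I : Subgroup (GL (Fin n) k)) (hn : (n : k) = 0) (hn0 : 0 < n) :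
    ¬ SolvAdequateBetween I := by
  rintro ⟨P, J, -, -, -, -, hadq⟩
  exact Subgroup.not_isThorneAdequate_of_natCast_eq_zero J hn hn0 hadq

end PerfectCore

/-! ## §2 The instance vocabulary of Lift_w / F† (verbatim from the tree texts; g8 kit `ImageThresholdSplit`) -/

section Cells

/-- DIAL of record (g8): «ρ̄|_{Γ_{K(ζ_ℓ)}} is absolutely irreducible» — clause (4) of the tree's `BLGGT2014_thmC_potentialAutomorphy`, the F† hypothesis. -/
def CycIrr {K : Type} [Field K] [NumberField K] {ℓ : ℕ} [Fact ℓ.Prime] {n : ℕ}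
    (ρ : FramedGaloisRep K (PadicAlgCl ℓ) n) : Prop :=
  (ρ.restrictField (CyclotomicField ℓ K)).IsResiduallyAbsIrreducible

/-- NEW DIAL 1 «ADQ» — **the engines' literal image hypothesis**: some (equivalently — Brauer–Nesbitt — every) absolutely irreducible reduction
`τ : Γ_{K(ζ_ℓ)} → GL_n(ℤ̄_ℓ/𝔪)` of `ρ|Γ_{K(ζ_ℓ)}` has THORNE-ADEQUATE IMAGE `τ(Γ_{K(ζ_ℓ)}) ≤ GL_n(𝔽̄_ℓ)` (tree `Subgroup.IsThorneAdequate`, Thorne 2012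
Def. 2.3 as amended by Guralnick–Herzig–Taylor–Thorne).  This is VERBATIM the hypothesis «r̄(G_{F(ζ_l)}) ⊂ GL_n(F̄_l) adequate» of Thorne 2012 Thm 7.1 =
BLGGT Thm 2.2.1 [corpus:paper:arxiv-1010.2561 p.19], BLGGT Thm 2.3.1/2.3.2 [ibid. p.20], ACC+ Thm 6.1.1 (enormous ⟹ adequate variants).
Lattice-free: for an absolutely irreducible reduction all reductions are conjugate, and adequacy is conjugation-invariant. -/
def AdequateCyclotomicImage {K : Type} [Field K] [NumberField K] {ℓ : ℕ} [Fact ℓ.Prime] {n : ℕ}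
    (ρ : FramedGaloisRep K (PadicAlgCl ℓ) n) : Prop :=
  ∃ τ : Field.absoluteGaloisGroup (CyclotomicField ℓ K) →* GL (Fin n) (padicAlgClResidueField ℓ),
    (ρ.restrictField (CyclotomicField ℓ K)).IsReductionOf (RingHom.id _) τ ∧ IsAbsIrreducible τ ∧ Subgroup.IsThorneAdequate τ.range

/-- NEW DIAL 2 «SADQ» — **solvably adequate image**: for some (⟺ every) absolutely irreducible reduction `τ` of `ρ|Γ_{K(ζ_ℓ)}` with image
`I = τ(Γ_{K(ζ_ℓ)})` and perfect core `P = 𝒟^∞(I)` (`IsPerfectCore`, inlined first-order), SOME intermediate group `P ≤ J ≤ I` acts absolutely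
irreducibly and is Thorne-adequate (`SolvAdequateBetween I`, §1b).  Galois correspondence: such `J` are exactly the residual images over the layers
`M` (K ⊆ M ⊆ N) of the finite solvable Galois hulls `N/K` — «after a solvable base change the engines' image hypothesis holds» (BLGGT's own move is
base change to a soluble extension DISJOINT from `K(ρ̄, ζ_ℓ)` to keep the image [corpus:paper:arxiv-1010.2561 p.25]; here the layer sits INSIDE
`K(ρ̄, ζ_ℓ)` to SHRINK an inadequate image to an adequate subgroup — e.g. SL₂(𝔽₃) ↦ Q₈ at ℓ = 3, Wiles' case).  ADQ ⟹ SADQ (`J = I`) and CORE ⟹ SADQ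
(`J = P`) at group level (`solvAdequateBetween_of_adequate/_of_core`); SADQ is MONOTONE up the solvable orbit (`SolvAdequateBetween.of_normal_…`,
PROVED), so its negation — the residual dial — is inherited by every solvable Galois restriction. -/
def SolvablyAdequateImage {K : Type} [Field K] [NumberField K] {ℓ : ℕ} [Fact ℓ.Prime] {n : ℕ}
    (ρ : FramedGaloisRep K (PadicAlgCl ℓ) n) : Prop :=
  ∃ τ : Field.absoluteGaloisGroup (CyclotomicField ℓ K) →* GL (Fin n) (padicAlgClResidueField ℓ),
    (ρ.restrictField (CyclotomicField ℓ K)).IsReductionOf (RingHom.id _) τ ∧ IsAbsIrreducible τ ∧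
      ∃ P J : Subgroup (GL (Fin n) (padicAlgClResidueField ℓ)), IsPerfectCore τ.range P ∧ P ≤ J ∧ J ≤ τ.range ∧
        IsAbsIrreducible J.subtype ∧ Subgroup.IsThorneAdequate J

/-- The field-level dial is the group-level predicate on the image (definitional). -/
theorem solvablyAdequateImage_iff {K : Type} [Field K] [NumberField K] {ℓ : ℕ} [Fact ℓ.Prime] {n : ℕ}
    (ρ : FramedGaloisRep K (PadicAlgCl ℓ) n) :
    SolvablyAdequateImage ρ ↔ ∃ τ : Field.absoluteGaloisGroup (CyclotomicField ℓ K) →* GL (Fin n) (padicAlgClResidueField ℓ),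
      (ρ.restrictField (CyclotomicField ℓ K)).IsReductionOf (RingHom.id _) τ ∧ IsAbsIrreducible τ ∧ SolvAdequateBetween τ.range := Iff.rfl

/-- ADQ ⟹ SADQ at the SAME reduction, given absolute irreducibility of the image's tautological representation (print: `IsAbsIrreducible τ ↔
IsAbsIrreducible τ.range.subtype`, same invariant subspaces; kept as a hypothesis, not re-proved here). -/
theorem solvablyAdequateImage_of_adequate {K : Type} [Field K] [NumberField K] {ℓ : ℕ} [Fact ℓ.Prime] {n : ℕ}
    {ρ : FramedGaloisRep K (PadicAlgCl ℓ) n} {τ : Field.absoluteGaloisGroup (CyclotomicField ℓ K) →* GL (Fin n) (padicAlgClResidueField ℓ)}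
    (hτ : (ρ.restrictField (CyclotomicField ℓ K)).IsReductionOf (RingHom.id _) τ) (hirr : IsAbsIrreducible τ)
    (hirr' : IsAbsIrreducible τ.range.subtype) (hadq : Subgroup.IsThorneAdequate τ.range) : SolvablyAdequateImage ρ :=
  ⟨τ, hτ, hirr, solvAdequateBetween_of_adequate hirr' hadq⟩

/-- The conclusion-with-hypotheses TAIL of Lift_w at one instance (K, n, hcpt, ℓ, ι, ρ) — the tree text of `OdlyzkoWorldSplit.AutomorphyLifting` /
`…IrreducibleSmallPrimeLifting` after its binders, verbatim (g8 kit). -/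
def LiftTail (K : Type) [Field K] [NumberField K] (n : ℕ) (hcpt : Literature.NumberTheory.Automorphic.isCompact_glFiniteIntegralLevel n K)
    (ℓ : ℕ) [Fact ℓ.Prime] (ι : PadicAlgCl ℓ ≃+* ℂ) (ρ : FramedGaloisRep K (PadicAlgCl ℓ) n) : Prop :=
  ρ.toGaloisRep.IsIrreducible → ((∀ᶠ v : IsDedekindDomain.HeightOneSpectrum (NumberField.RingOfIntegers K) in cofinite, ρ.IsUnramifiedAt v) ∧ ∀ (v : IsDedekindDomain.HeightOneSpectrum (NumberField.RingOfIntegers K)) (hv : ((ℓ : ℕ) : NumberField.RingOfIntegers K) ∈ v.asIdeal), (Literature.NumberTheory.PAdicHodge.fontainePstAdicCompletion v ℓ hv).IsDeRhamFramed (ρ.toLocal v)) → (∃ (π : Literature.NumberTheory.Automorphic.CuspidalAutomorphicRepData n K hcpt) (ρ' : Literature.NumberTheory.GaloisRepresentations.FramedGaloisRep K (PadicAlgCl ℓ) n), π.1.IsLAlgebraic ∧ ρ'.toGaloisRep.IsIrreducible ∧ (∀ᶠ v : IsDedekindDomain.HeightOneSpectrum (NumberField.RingOfIntegers K) in cofinite,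 SatakeFrobCompatibleAt ι π.1 ρ' v) ∧ ∀ᶠ v : IsDedekindDomain.HeightOneSpectrum (NumberField.RingOfIntegers K) in cofinite, ∃ P P' : Polynomial (Valued.v : Valuation (PadicAlgCl ℓ) NNReal).valuationSubring, ρ.HasFrobCharpolyAt v (P.map (Valued.v : Valuation (PadicAlgCl ℓ) NNReal).valuationSubring.subtype) ∧ ρ'.HasFrobCharpolyAt v (P'.map (Valued.v : Valuation (PadicAlgCl ℓ) NNReal).valuationSubring.subtype) ∧ P.map (IsLocalRing.residue (Valued.v : Valuation (PadicAlgCl ℓ) NNReal).valuationSubring) = P'.map (IsLocalRing.residue (Valued.v : Valuation (PadicAlgCl ℓ) NNReal).valuationSubring)) → ∃ π : Literature.NumberTheory.Automorphic.CuspidalAutomorphicRepData n K hcpt, π.1.IsLAlgebraic ∧ ∀ᶠ v : IsDedekindDomain.HeightOneSpectrum (NumberField.RingOfIntegers K) in cofinite, SatakeFrobCompatibleAt ι π.1 ρ v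


/-- Lift_w AT RANK n (all K, hcpt, ℓ, ι, ρ). -/
def LiftAt (n : ℕ) : Prop :=
  ∀ (K : Type) [Field K] [NumberField K] (hcpt : Literature.NumberTheory.Automorphic.isCompact_glFiniteIntegralLevel n K), 0 < n →
    ∀ (ℓ : ℕ) [Fact ℓ.Prime] (ι : PadicAlgCl ℓ ≃+* ℂ) (ρ : FramedGaloisRep K (PadicAlgCl ℓ) n), LiftTail K n hcpt ℓ ι ρ

/-- IH(n): Lift_w at every rank m < n (inlined verbatim in the tree texts of A†, F†, RPO, RNO₂, RNO₃). -/
def LiftBelow (n : ℕ) : Prop :=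
  ∀ m : ℕ, m < n → LiftAt m

/-- F† STRUCTURED = the TARGET `OdlyzkoWorldSplit.IrreducibleSmallPrimeLifting` (stmt-Langlands-33907): FINITE RANGE ℓ < 2(n+1) ∧ ρ̄|Γ_{K(ζ_ℓ)} abs.
irreducible, under IH(n).  Certified IDENTICAL to the tree decl (`fdagger_iff_tree`, `Iff.rfl`). -/
def FDagger : Prop :=
  ∀ (K : Type) [Field K] [NumberField K] (n : ℕ) (hcpt : Literature.NumberTheory.Automorphic.isCompact_glFiniteIntegralLevel n K), 0 < n →
    LiftBelow n → ∀ (ℓ : ℕ) [Fact ℓ.Prime] (ι : PadicAlgCl ℓ ≃+* ℂ) (ρ : FramedGaloisRep K (PadicAlgCl ℓ) n),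
      ℓ < 2 * (n + 1) → CycIrr ρ → LiftTail K n hcpt ℓ ι ρ

/-- The structured F† IS the tree decl (item 33907), definitionally. -/
theorem fdagger_iff_tree : FDagger ↔ OdlyzkoWorldSplit.IrreducibleSmallPrimeLifting := Iff.rfl

/-! ## §3 The three cells (F†'s text with the dial literals inserted after `CycIrr ρ`, nothing else re-typed) -/

/-- **AIL — ADEQUATE-IMAGE SMALL-PRIME LIFTING** (cell 1, the ENGINE CELL; WEAKER; ATTACKABLE-BY-ENGINE verbatim): F† on the instances whose residual
image over K(ζ_ℓ) is Thorne-adequate — literally the printed image hypothesis of Thorne 2012 Thm 7.1 / BLGGT 2.2.1, 2.3.1 / ACC+ 6.1.1 / Miagkov–Thorne,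
which carry NO condition «ℓ ≥ 2(n+1)» (that inequality enters print only through GHTT Prop 2.1.2 «ℓ ≥ 2(n+1) ∧ irreducible ⟹ adequate», i.e. through A†).
What is left dark inside AIL is exactly A†'s transverse darkness (irregular weights / non-CM field / no polarisation / local conditions at ℓ), carved by
other lenses. -/
def AdequateImageLifting : Prop :=
  ∀ (K : Type) [Field K] [NumberField K] (n : ℕ) (hcpt : Literature.NumberTheory.Automorphic.isCompact_glFiniteIntegralLevel n K), 0 < n →
    LiftBelow n → ∀ (ℓ : ℕ) [Fact ℓ.Prime] (ι : PadicAlgCl ℓ ≃+* ℂ) (ρ : FramedGaloisRep K (PadicAlgCl ℓ) n),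
      ℓ < 2 * (n + 1) → CycIrr ρ → AdequateCyclotomicImage ρ → LiftTail K n hcpt ℓ ι ρ

/-- **SBL — SOLVABLY-ADEQUATE SMALL-PRIME LIFTING** (cell 2, the BRIDGE CELL; WEAKER; CLOSED IN PRINT modulo AIL + W⁺ by the transport
support `SolvableAdequacyTransport`): the image over K(ζ_ℓ) is NOT adequate but some layer `M` of a solvable Galois hull `N/K` has adequate
(absolutely irreducible) image.  Bridge: the link antecedent travels K → N (`BrightMateBypass.SolvableAscentConstituent`, Arthur–Clozel) → M
(`…CliffordSolvableDescent` along the Galois N/M); AIL over M (F†'s IH is field-uniform, ℓ and the geometric clauses restrict); then M → N → K the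
same way (ρ irreducible over K is F†'s hypothesis).  Rank-2 content: at ℓ = 3 EVERY inadequate irreducible image (projectively PSL₂(𝔽₃), BLGG13
Prop. 6.2.1 [corpus:paper:arxiv-1106.5586 p.21]) is solvably adequate via its Q₈-layer — Wiles' SL₂(𝔽₃). -/
def SolvablyAdequateLifting : Prop :=
  ∀ (K : Type) [Field K] [NumberField K] (n : ℕ) (hcpt : Literature.NumberTheory.Automorphic.isCompact_glFiniteIntegralLevel n K), 0 < n →
    LiftBelow n → ∀ (ℓ : ℕ) [Fact ℓ.Prime] (ι : PadicAlgCl ℓ ≃+* ℂ) (ρ : FramedGaloisRep K (PadicAlgCl ℓ) n),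
      ℓ < 2 * (n + 1) → CycIrr ρ → ¬ AdequateCyclotomicImage ρ → SolvablyAdequateImage ρ → LiftTail K n hcpt ℓ ι ρ

/-- **RSL — NO-ADEQUATE-LAYER SMALL-PRIME LIFTING** (cell 3, the FINITE-TABLE CELL; WEAKER; DECLARED RESIDUAL; INSTRUMENTABLE): the image `I` over
K(ζ_ℓ) is absolutely irreducible and NO group between its perfect core and `I` is adequate-irreducible — by §1b an invariant inherited by every
solvable Galois restriction, so no solvable base change followed by descent reaches these instances from AIL ∪ SBL (not a costume).  Residual of
the ADEQUACY technology, a table indexed by (n, ℓ < 2(n+1), perfect core P, interval [P, I]): the slab ℓ ∣ n (tree `not_isThorneAdequate_of_natCast_…`;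
`not_solvAdequateBetween_of_natCast_eq_zero`) — in particular all of (n, ℓ) = (2, 2); rank 2, ℓ odd: EXACTLY ℓ = 5 with projective image PSL₂(𝔽₅) or
PGL₂(𝔽₅) (BLGG13 Prop. 6.2.1 [corpus:paper:arxiv-1106.5586 p.21, p.24]; P = SL₂(𝔽₅) inadequate, every overgroup too) — the classical p = 5 exception
of Wiles/Kisin, where GL₂-specific engines (Taylor–Wiles condition weaker than adequacy) exist over totally real K; for n < ℓ < 2(n+1) the
Guralnick–Herzig–Tiep list [corpus:paper:arxiv-1311.1786 p.3 Thm 1.3]; for ℓ ≤ n (possible as soon as n ≥ 3) uncatalogued beyond degree ℓ.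
R1 CARVES (critic rows 167/169, rule of record «the residual books no kit-closable sub-box»): the instances that are SOLVABLY REDUCIBLE
(`Theorems.BrightMate.SolvablyReducible ρ`: closed by IH(m) + Serre_w(OW, RES) + W⁺ + CSD, landed `weakAut_of_solvablyReducible`) or SOLVABLY MATED
(`Theorems.BrightMate.SolvablyMated ι ρ`: a PSW family through ρ over a layer of a solvable Galois hull — closed by the landed bright-mate bypass
`weakAut_of_solvablyMated` modulo BRIGHT + Serre_w + W⁺ + A† + AUT↑ + CSD, whatever the prime and the image) are EXCLUDED, by the two clauses of
route BrightMateBypass VERBATIM.  What is booked: small prime, no adequate layer, solvably irreducible, absolutely lone (a sub-box of the LONE‴ ghost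
27677 transported to the cyclotomically irreducible small-prime cell; conjecturally empty by Fontaine–Mazur + Langlands, no theorem says so). -/
def NoAdequateLayerLifting : Prop :=
  ∀ (K : Type) [Field K] [NumberField K] (n : ℕ) (hcpt : Literature.NumberTheory.Automorphic.isCompact_glFiniteIntegralLevel n K), 0 < n →
    LiftBelow n → ∀ (ℓ : ℕ) [Fact ℓ.Prime] (ι : PadicAlgCl ℓ ≃+* ℂ) (ρ : FramedGaloisRep K (PadicAlgCl ℓ) n),
      ℓ < 2 * (n + 1) → CycIrr ρ → ¬ AdequateCyclotomicImage ρ → ¬ SolvablyAdequateImage ρ →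
        ¬ Theorems.BrightMate.SolvablyReducible ρ → ¬ Theorems.BrightMate.SolvablyMated ι ρ → LiftTail K n hcpt ℓ ι ρ

/-- **TRANS — SOLVABLE ADEQUACY TRANSPORT** (support; PRINT modulo its antecedents, all BY NAME: W⁺ = host item 17415, the two solvable transports
AUT↑ = `BrightMateBypass.SolvableAscentConstituent` 27679 (up a solvable Galois N/K to a constituent) and CSD = `HolomorphicLimitSplit.CliffordSolvableDescent`
31695 (down) — and the
engine cell AIL over ALL number fields): Galois correspondence `J = ρ̄(Γ_{M(ζ_ℓ)})` for the layer `M = K(ρ̄,ζ_ℓ)^{B}`, `B = (ρ̄|Γ_{K(ζ_ℓ)})⁻¹(J) ⊇ R`,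
of the hull `N = K(ρ̄,ζ_ℓ)^{R}`, `R` = perfect core of Gal(K(ρ̄,ζ_ℓ)/K) (so N/K and N/M are solvable Galois); link K → N → M; AIL at M; M → N → K. -/
def SolvableAdequacyTransport : Prop :=
  OdlyzkoWorldSplit.SatakeAvatarExistence → BrightMateBypass.SolvableAscentConstituent → HolomorphicLimitSplit.CliffordSolvableDescent →
    AdequateImageLifting → SolvablyAdequateLifting

/-- FRAME — the HOST ROUTE VERBATIM with F† abstracted: «F† → Langlands», i.e. the eleven other binders of `OdlyzkoWorldSplit.closes` (OW, RES, A†, RPO,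
RNO₂, RNO₃, W⁺, P, L∤R, CRD) composed with the closed resplit glue `AutomorphyLifting_of_slopesplit` 33911 — node kernel `frame_of_host`.  Never staffed. -/
def SmallPrimeLiftingFrame : Prop :=
  OdlyzkoWorldSplit.IrreducibleSmallPrimeLifting → _root_.Langlands

end Cells

end Summit.Langlands.Langlands.Theorems.CoreAdequacy
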